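import Summits.QuantumFields.YangMills.Theorems.TwistedTraceScaling.Negative.ShellWitnessBelowThreshold
import HarnessLib

/-!
# Negative lemma R71 (crux `TwistedTraceScaling`, stmt-QuantumFields-20203): the DOMINATION WINDOW of a thin exponent-shell `(a, b)` of lane A's C4-SHELL cut is
# `3a/2 < min(2b, 2/5)` together with `a < 1/5` — the card's rule `a < 4b/3`, PLUS the cap `a < 4/15` forced by the fixed rate `β^{−1/5}` of the central quasimode —
# and the arithmetic of the shell chain (`n` shells of ratio `< 4/3` from `a₀` down to `1/40` exist only if `a₀ < (4/3)ⁿ/40`; the card's 8-chain certified)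

Standing disprover `ym-cdisprove-20203-1` (gen 57), vetting lead g23's card `pub/ym-fleet/ym-luscher-20007-p1/Lines-shell-gain.md` (C4-SHELL cut into finitely many THIN
EXPONENT-SHELLS `(a, b) = InnerShellGainSmallAt L (β^{−a}) (β^{−b}) (β^{−17/20})`, glued by ✓`valleyGainAt_pow_of_shellSmall`, each shell a Born–Oppenheimer package on the tube of
slow radius `β^{−b}` closed by DOMINATION: `A·λ_b + 6κ_b + 2b_b²/θ₀ ≤ g_a`, where `g_a ≍ (β^{−a}/C_L)^{3/2}/80` is the one-site annulus gain (✓`oneSite_annulus_gain_orbitDist`,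
window `t ≥ (L³β)^{−1/5}`), `κ_b = 2β^{−2b}ℓ⁹` the (B-T) fibre error (✓`profileB_hT`), `b_b` the (B-OD) rate and `θ₀` the (B-ST) constant).  EXPONENTS ONLY (constants, `L`-factors and
polylogarithms `ℓ = btLog β` are not modelled; every comparison below is "`C·β^{−q} ≤ β^{−p}` for EVERY `C`, eventually", `R24.forall_mul_powScale_le_eventually_iff`):
* §1 ★★ THE WINDOW.  The (B-OD) rate of record is `b_core = (ε + κ_P)·√(8/…)` (✓`core_defect_currency`) with `κ_P = C_p(43β^{−b})²` and `ε ≥ η_c = β^{−1/5}` — the FIXED rate of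
  the central quasimode (✓`central_ratio_rate`: `hi₀ ≤ (1 + β^{−1/5})lo₀`) — besides the smearing-window term `≍ C_L ℓ⁴β^{−b}` of `coreEta` (R50/R52); hence the costs carry the
  scales `β^{−2b}` (`κ_b`, window term squared), `β^{−4b}` (`κ_P²`) and `β^{−2/5}` (`η_c²`), the gain the scale `β^{−3a/2}`:
  `domination_scales_iff` — each cost is eventually below every multiple of the gain iff `3a/2 < 2b`, resp. `3a/2 < 4b`, resp. `3a/2 < 2/5`; `thin_shell_rule_iff` (`↔ a < 4b/3`),
  `quasimode_cap_iff` (`↔ a < 4/15`), ★★ `domination_window_iff` — all three at once iff `a < 4b/3 ∧ a < 4/15` (`0 < b`), ★ `domination_sum_iff` (the summed cost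
  `C(β^{−2b} + β^{−2/5}) ≤ β^{−3a/2}` for every `C`, eventually, iff the same) ; `quasimode_cap_of_lt_fifth` — the cap is automatic for `a < 1/5` (margin `1/15`), so it bites no
  shell of the card but MUST appear in the domination clause of `ShellBricks`; `oneSite_threshold_iff` — the one-site window `C·β^{−1/5} ≤ β^{−a}` for every `C`, eventually,
  iff `a < 1/5`; `linear_rate_rule_iff` — with a LINEAR one-site rate (gain scale `β^{−a}`, R70) the rule would be `a < 2b`.
* §2 ★ THE CHAIN.  `chain_lower_bound` — `n+1` consecutive ratios `< r` (`0 < r`) force `a 0 < r^{n+1}·a (n+1)`; hence `no_seven_chain` — no 7-shell chain of ratio `< 4/3` from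
  `a₀` down to `1/40` when `(4/3)⁷/40 ≤ a₀`, with `(4/3)⁷/40 = 2048/10935 ∈ (1/6, 19/100)` (`seven_chain_threshold`): the card's `a₀ = 19/100` needs 8 shells, an `a₀ ∈ (1/6, 2048/10935)`
  only 7 (`seven_chain_example` from `a₀ = 9/50`); ★ `record_chain_certificate` — the card's chain `19/100, 29/200, 11/100, 21/250, 8/125, 49/1000, 37/1000, 7/250, 1/40` has all 8
  ratios `< 4/3`, all exponents in `(0, 1/5)` (so below the one-site threshold and the quasimode cap), all outer exponents `< 1/3` (IMS inside the glue), and `a₀ ∈ (1/6, 1/5)`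
  (C4-CORE window); `record_chain_exists` packages it as a function `ℕ → ℝ`.
READING (cycle 57, with UPDATE 29): the card's window `b < a < 4b/3` IS the window of the `t^{3/2}` rate once the quasimode cap is recorded; nothing here refutes a landed text.
The `1/6 < s` hypotheses of the record cone are NOT in this window: they enter only through the Feshbach smallness `κ, b² = o(λ_b)` (R37 `window_of_recordInput`, R52) and the kinetic
stiff separation (bypassed by R59 `eventually_hsep_magnetic`, every `s > 0`) — see UPDATE 29 / Disproof.lean §BO.

HONEST FRAMING: exponent bookkeeping for the SHELL brick of stub S-BASE (C4) of a child of the CONDITIONAL reduction route R2b1 (rank 202); nothing here is `¬TwistedTraceScaling`,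
nothing is a gap, nothing is Clay.  Not Mathlib material: project-specific bookkeeping.
-/

set_option autoImplicit false

noncomputable section

open Real
open Summit.QuantumFields.YangMills.Theorems.FemtoTransferGap

namespace Summit.QuantumFields.YangMills.Theorems.TwistedTraceScaling.Negative.R71

/-! ## §1 The domination window of one thin shell `(a, b)` -/

/-- ★★ **The three cost scales against the gain scale `β^{−3a/2}`**, as eventual statements valid for every constant: `κ_b`/window term (`β^{−2b}`) iff `3a/2 < 2b`;
`κ_P²` (`β^{−4b}`) iff `3a/2 < 4b`; the central quasimode's `η_c² = β^{−2/5}` iff `3a/2 < 2/5`. [folklore] -/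
theorem domination_scales_iff {a b : ℝ} :
    ((∀ C : ℝ, ∃ β0 : ℝ, ∀ β : ℝ, β0 ≤ β → C * powScale (2 * b) β ≤ powScale (3 * a / 2) β) ↔ 3 * a / 2 < 2 * b) ∧
      ((∀ C : ℝ, ∃ β0 : ℝ, ∀ β : ℝ, β0 ≤ β → C * powScale (4 * b) β ≤ powScale (3 * a / 2) β) ↔ 3 * a / 2 < 4 * b) ∧
        ((∀ C : ℝ, ∃ β0 : ℝ, ∀ β : ℝ, β0 ≤ β → C * powScale (2 / 5) β ≤ powScale (3 * a / 2) β) ↔ 3 * a / 2 < 2 / 5) :=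
  ⟨R24.forall_mul_powScale_le_eventually_iff, R24.forall_mul_powScale_le_eventually_iff, R24.forall_mul_powScale_le_eventually_iff⟩

/-- **The card's thin-shell rule**: `3a/2 < 2b ↔ a < 4b/3`. [folklore] -/
theorem thin_shell_rule_iff {a b : ℝ} : 3 * a / 2 < 2 * b ↔ a < 4 * b / 3 := by
  constructor <;> intro h <;> linarith

/-- **The quasimode cap**: `3a/2 < 2/5 ↔ a < 4/15`. [folklore] -/
theorem quasimode_cap_iff {a : ℝ} : 3 * a / 2 < 2 / 5 ↔ a < 4 / 15 := by
  constructor <;> intro h <;> linarith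

/-- ★★ **DOMINATION WINDOW of a thin shell** (`0 < b`): all three exponent conditions hold iff `a < 4b/3 ∧ a < 4/15` (the `κ_P²` condition `3a/2 < 4b` is implied by the first).
[folklore] -/
theorem domination_window_iff {a b : ℝ} (hb : 0 < b) :
    (3 * a / 2 < 2 * b ∧ 3 * a / 2 < 4 * b ∧ 3 * a / 2 < 2 / 5) ↔ (a < 4 * b / 3 ∧ a < 4 / 15) := by
  constructor
  · rintro ⟨h1, -, h3⟩
    exact ⟨by linarith, by linarith⟩
  · rintro ⟨h1, h2⟩
    exact ⟨by linarith, by linarith, by linarith⟩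

/-- ★ **Summed form**: `C·(β^{−2b} + β^{−2/5}) ≤ β^{−3a/2}` for EVERY `C`, eventually, iff `a < 4b/3 ∧ a < 4/15`. [folklore] -/
theorem domination_sum_iff {a b : ℝ} :
    (∀ C : ℝ, ∃ β0 : ℝ, ∀ β : ℝ, β0 ≤ β → C * (powScale (2 * b) β + powScale (2 / 5) β) ≤ powScale (3 * a / 2) β) ↔
      (a < 4 * b / 3 ∧ a < 4 / 15) := by
  obtain ⟨i1, -, i3⟩ := @domination_scales_iff a b
  constructor
  · intro h
    have hsplit : ∀ q : ℝ, (∀ β, powScale q β ≤ powScale (2 * b) β + powScale (2 / 5) β) →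
        ∀ C : ℝ, ∃ β0 : ℝ, ∀ β : ℝ, β0 ≤ β → C * powScale q β ≤ powScale (3 * a / 2) β := by
      intro q hq C
      obtain ⟨β0, hβ⟩ := h (max C 0)
      refine ⟨β0, fun β hβ0 => ?_⟩
      have hC : C * powScale q β ≤ max C 0 * powScale q β := mul_le_mul_of_nonneg_right (le_max_left _ _) (powScale_pos _ _).le
      have hm : max C 0 * powScale q β ≤ max C 0 * (powScale (2 * b) β + powScale (2 / 5) β) := mul_le_mul_of_nonneg_left (hq β) (le_max_right _ _)
      exact hC.trans (hm.trans (hβ β hβ0))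
    have h1 := i1.1 (hsplit (2 * b) fun β => le_add_of_nonneg_right (powScale_pos _ _).le)
    have h3 := i3.1 (hsplit (2 / 5) fun β => le_add_of_nonneg_left (powScale_pos _ _).le)
    exact ⟨by linarith, by linarith⟩
  · rintro ⟨h1, h3⟩ C
    -- `C·x + C·y ≤ g/2 + g/2`: run each comparison with the constant `2C` against the gain
    obtain ⟨β1, hβ1⟩ := i1.2 (by linarith) (2 * C)
    obtain ⟨β3, hβ3⟩ := i3.2 (by linarith) (2 * C)
    refine ⟨max β1 β3, fun β hβ => ?_⟩
    have e1 := hβ1 β ((le_max_left _ _).trans hβ)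
    have e3 := hβ3 β ((le_max_right _ _).trans hβ)
    linarith [e1, e3]

/-- **The cap is automatic below the one-site threshold**: `a < 1/5 → a < 4/15`; `1/5 < 4/15`, margin `4/15 − 1/5 = 1/15`. [folklore] -/
theorem quasimode_cap_of_lt_fifth {a : ℝ} (ha : a < 1 / 5) : a < 4 / 15 ∧ (1 : ℝ) / 5 < 4 / 15 ∧ (4 : ℝ) / 15 - 1 / 5 = 1 / 15 :=
  ⟨by linarith, by norm_num, by norm_num⟩

/-- **One-site threshold**: the annulus gain needs `t ≍ β^{−a}/C_L ≥ (L³β)^{−1/5}`, i.e. `C·β^{−1/5} ≤ β^{−a}` for every `C`, eventually — iff `a < 1/5`. [folklore] -/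
theorem oneSite_threshold_iff {a : ℝ} :
    (∀ C : ℝ, ∃ β0 : ℝ, ∀ β : ℝ, β0 ≤ β → C * powScale (1 / 5) β ≤ powScale a β) ↔ a < 1 / 5 :=
  R24.forall_mul_powScale_le_eventually_iff

/-- **With a LINEAR one-site rate** (gain scale `β^{−a}`, R70) the fibre error `β^{−2b}` is dominated iff `a < 2b` (then 4 shells of ratio `< 2` reach `1/40` from below `1/5`,
as `2⁴·(1/40) = 2/5 > 1/5`). [folklore] -/
theorem linear_rate_rule_iff {a b : ℝ} :
    ((∀ C : ℝ, ∃ β0 : ℝ, ∀ β : ℝ, β0 ≤ β → C * powScale (2 * b) β ≤ powScale a β) ↔ a < 2 * b) ∧ (2 : ℝ) ^ 4 * (1 / 40) = 2 / 5 ∧ (1 : ℝ) / 5 < 2 / 5 :=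
  ⟨R24.forall_mul_powScale_le_eventually_iff, by norm_num, by norm_num⟩

/-! ## §2 The shell chain -/

/-- ★ **Chain lower bound**: if `a i < r·a (i+1)` for all `i ≤ n` (`0 < r`), then `a 0 < r^{n+1}·a (n+1)`. [folklore] -/
theorem chain_lower_bound {r : ℝ} (hr : 0 < r) :
    ∀ (n : ℕ) (a : ℕ → ℝ), (∀ i : ℕ, i ≤ n → a i < r * a (i + 1)) → a 0 < r ^ (n + 1) * a (n + 1) := by
  intro n
  induction n with
  | zero =>
    intro a h
    simpa using h 0 le_rfl
  | succ n ih =>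
    intro a h
    have h0 : a 0 < r * a 1 := h 0 (Nat.zero_le _)
    have h1 : a 1 < r ^ (n + 1) * a (n + 1 + 1) := by
      have := ih (fun i => a (i + 1)) fun i hi => h (i + 1) (by omega)
      simpa using this
    have h2 : r * a 1 < r * (r ^ (n + 1) * a (n + 1 + 1)) := mul_lt_mul_of_pos_left h1 hr
    have h3 : r * (r ^ (n + 1) * a (n + 1 + 1)) = r ^ (n + 1 + 1) * a (n + 1 + 1) := by ring
    linarith

/-- **Seven-shell threshold**: `(4/3)⁷/40 = 2048/10935`, and `1/6 < 2048/10935 < 19/100 < 1/5`. [folklore] -/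
theorem seven_chain_threshold :
    (4 / 3 : ℝ) ^ 7 / 40 = 2048 / 10935 ∧ (1 : ℝ) / 6 < 2048 / 10935 ∧ (2048 : ℝ) / 10935 < 19 / 100 ∧ (19 : ℝ) / 100 < 1 / 5 := by
  refine ⟨by norm_num, by norm_num, by norm_num, by norm_num⟩

/-- ★ **No 7-shell chain from `a₀ ≥ (4/3)⁷/40`** (in particular from the card's `a₀ = 19/100`): there is no `a : ℕ → ℝ` with `a 0 = a₀`, `a 7 = 1/40` and the seven ratios
`a i < (4/3)·a (i+1)`, `i ≤ 6`. [folklore] -/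
theorem no_seven_chain {a₀ : ℝ} (h : (4 / 3 : ℝ) ^ 7 / 40 ≤ a₀) :
    ¬ ∃ a : ℕ → ℝ, a 0 = a₀ ∧ a 7 = 1 / 40 ∧ ∀ i : ℕ, i ≤ 6 → a i < 4 / 3 * a (i + 1) := by
  rintro ⟨a, ha0, ha7, hr⟩
  have hlb := chain_lower_bound (r := 4 / 3) (by norm_num) 6 a hr
  have h7 : a (6 + 1) = 1 / 40 := ha7
  rw [ha0, h7] at hlb
  norm_num at hlb h
  linarith

/-- The card's `a₀ = 19/100` is above the seven-shell threshold (so its chain has 8 shells, as it does). [folklore] -/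
theorem no_seven_chain_record : ¬ ∃ a : ℕ → ℝ, a 0 = 19 / 100 ∧ a 7 = 1 / 40 ∧ ∀ i : ℕ, i ≤ 6 → a i < 4 / 3 * a (i + 1) :=
  no_seven_chain (by norm_num)

/-- ★ **The card's 8-shell chain, certified**: `19/100, 29/200, 11/100, 21/250, 8/125, 49/1000, 37/1000, 7/250, 1/40` — all eight ratios `< 4/3` (the largest is `49/37`),
all nine exponents in `(0, 1/5)` (one-site threshold; hence `< 4/15`, the quasimode cap), all eight outer exponents `< 1/3` (IMS cuts `o(λ_b)` inside the glue), and
`a₀ = 19/100 ∈ (1/6, 1/5)` (the C4-CORE window of ✓`coarseUpper_of_valleyGain`). [folklore] -/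
theorem record_chain_certificate :
    ((19 : ℝ) / 100 < 4 / 3 * (29 / 200) ∧ (29 : ℝ) / 200 < 4 / 3 * (11 / 100) ∧ (11 : ℝ) / 100 < 4 / 3 * (21 / 250) ∧
      (21 : ℝ) / 250 < 4 / 3 * (8 / 125) ∧ (8 : ℝ) / 125 < 4 / 3 * (49 / 1000) ∧ (49 : ℝ) / 1000 < 4 / 3 * (37 / 1000) ∧
      (37 : ℝ) / 1000 < 4 / 3 * (7 / 250) ∧ (7 : ℝ) / 250 < 4 / 3 * (1 / 40)) ∧
    ((1 : ℝ) / 6 < 19 / 100 ∧ (19 : ℝ) / 100 < 1 / 5) ∧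
    ((0 : ℝ) < 1 / 40 ∧ (1 : ℝ) / 40 < 7 / 250 ∧ (7 : ℝ) / 250 < 37 / 1000 ∧ (37 : ℝ) / 1000 < 49 / 1000 ∧ (49 : ℝ) / 1000 < 8 / 125 ∧
      (8 : ℝ) / 125 < 21 / 250 ∧ (21 : ℝ) / 250 < 11 / 100 ∧ (11 : ℝ) / 100 < 29 / 200 ∧ (29 : ℝ) / 200 < 19 / 100) ∧
    ((29 : ℝ) / 200 < 1 / 3 ∧ (19 : ℝ) / 100 < 4 / 15) := by
  refine ⟨⟨?_, ?_, ?_, ?_, ?_, ?_, ?_, ?_⟩, ⟨?_, ?_⟩, ⟨?_, ?_, ?_, ?_, ?_, ?_, ?_, ?_, ?_⟩, ⟨?_, ?_⟩⟩ <;> norm_num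

/-- The card's chain as a function: an 8-shell chain of ratio `< 4/3` from `19/100` to `1/40` with every exponent in `(0, 1/5)`. [folklore] -/
theorem record_chain_exists : ∃ a : ℕ → ℝ, a 0 = 19 / 100 ∧ a 8 = 1 / 40 ∧ (∀ i : ℕ, i ≤ 7 → a i < 4 / 3 * a (i + 1)) ∧
    ∀ i : ℕ, i ≤ 8 → 0 < a i ∧ a i < 1 / 5 := by
  refine ⟨fun i => if i = 0 then 19 / 100 else if i = 1 then 29 / 200 else if i = 2 then 11 / 100 else if i = 3 then 21 / 250 else if i = 4 then 8 / 125 else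
      if i = 5 then 49 / 1000 else if i = 6 then 37 / 1000 else if i = 7 then 7 / 250 else 1 / 40,
    by norm_num, by norm_num, ?_, ?_⟩
  · intro i hi
    interval_cases i <;> norm_num
  · intro i hi
    interval_cases i <;> norm_num

/-- **A 7-shell chain exists below the threshold**, e.g. from `a₀ = 9/50 ∈ (1/6, 2048/10935)`: `9/50, 17/125, 513/5000, 387/5000, 73/1250, 881/20000, 133/4000, 1/40`
(ratios `< 4/3`, exponents in `(0, 1/5)`). [folklore] -/
theorem seven_chain_example : ∃ a : ℕ → ℝ, a 0 = 9 / 50 ∧ a 7 = 1 / 40 ∧ (∀ i : ℕ, i ≤ 6 → a i < 4 / 3 * a (i + 1)) ∧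
    (∀ i : ℕ, i ≤ 7 → 0 < a i ∧ a i < 1 / 5) ∧ (1 : ℝ) / 6 < 9 / 50 ∧ (9 : ℝ) / 50 < 2048 / 10935 := by
  refine ⟨fun i => if i = 0 then 9 / 50 else if i = 1 then 17 / 125 else if i = 2 then 513 / 5000 else if i = 3 then 387 / 5000 else if i = 4 then 73 / 1250 else
      if i = 5 then 881 / 20000 else if i = 6 then 133 / 4000 else 1 / 40,
    by norm_num, by norm_num, ?_, ?_, by norm_num, by norm_num⟩
  · intro i hi
    interval_cases i <;> norm_num
  · intro i hi
    interval_cases i <;> norm_num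

/-! ## §3 The ledger at once -/

/-- ★★ **Shell ledger** for a thin shell `(a, b)` with `a < 1/5`: DOMINATION (summed form) iff `a < 4b/3` (the cap `a < 4/15` being automatic), the one-site threshold
holds, and the linear-rate rule would be `a < 2b`. [folklore] -/
theorem shell_ledger {a b : ℝ} (ha : a < 1 / 5) :
    ((∀ C : ℝ, ∃ β0 : ℝ, ∀ β : ℝ, β0 ≤ β → C * (powScale (2 * b) β + powScale (2 / 5) β) ≤ powScale (3 * a / 2) β) ↔ a < 4 * b / 3) ∧
      (∀ C : ℝ, ∃ β0 : ℝ, ∀ β : ℝ, β0 ≤ β → C * powScale (1 / 5) β ≤ powScale a β) ∧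
        ((∀ C : ℝ, ∃ β0 : ℝ, ∀ β : ℝ, β0 ≤ β → C * powScale (2 * b) β ≤ powScale a β) ↔ a < 2 * b) := by
  refine ⟨?_, oneSite_threshold_iff.2 ha, linear_rate_rule_iff.1⟩
  rw [domination_sum_iff]
  exact ⟨fun h => h.1, fun h => ⟨h, by linarith⟩⟩

end Summit.QuantumFields.YangMills.Theorems.TwistedTraceScaling.Negative.R71

end
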